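import Literature.AnabelianGeometry.SemiGraphs.SpecialFibreDerivedGraphAction
import HarnessLib

/-!
# The Cor-3.9-derived graph action `Π → Aut 𝔾` on the cusp-omitted special fibre: vertex part, `Δ`-triviality,
# `hHstab` from node-stability, agreement with the `PiData` record (proof-only)

Mochizuki, *Semi-graphs of anabelioids*, Publ. RIMS **42** (2006), Cor. 3.9 pp. 42–43, Thm. 3.7 (iv) p. 41, Ex. 3.10
p. 44 [cite: MochizukiSemiAnbd2006, Cor 3.9 pp.42-43]; Mochizuki, *Inter-universal Teichmüller theory I*, §2 p. 47
l. 22–24 ("stabilized by the natural action of `G_k` on `𝔾`"), Cor. 2.3 (i) p. 47 ("the natural outer actions of `G_k`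
on `Δ^tp_X` … determine natural outer actions of `G_k` on `Δ^tp_{X,ℍ}`") [cite: Mochizuki2012, IUTchI Cor 2.3(i) p.47]
[claim: Mochizuki2012, status: disputed] (nothing of the IUT series is asserted here).

abc-iut cell, layer L3, seat abc-iut-L3-d1 gen 12, in-lineage sequel «DERIVED-ACTGRAPH@SPECIAL-FIBRE» (L3-lead δ6 (2)
GO), PROOF-ONLY companion of `SpecialFibreDerivedGraphAction.lean` (no definition, no instance, no notation, no `Prop`
fact); inputs BY NAME: gen 11's A2/A3/A5 (`SpecialFibreConjugationGraphic.lean`), gen 12's stages 1–2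
(`SpecialFibreConjugationDecompTransport.lean`, `SpecialFibreDecompSubgroupsCuspOmission.lean`).

WHAT IS PROVED (finite `𝒢^c`, every `g ∈ Π`).
* `derivedActGraph_vertexMap` — the vertex part of `derivedActGraph g` IS the derived vertex action `actVertex g`
  (A3; Thm. 3.7 (iv) at the finite `𝒢^c`);
* `derivedActGraph_coe_delta`, `delta_le_ker_derivedActGraph` — `Δ` acts trivially (A5: `autOfConj δ` is inner), so
  the action factors through `Π/Δ = G_K`: print's "natural action of `G_K` on `𝔾`", CONSTRUCTED not posited;
* `base_eq_derivedActGraph_hom` — every locally open `F₀ : 𝒢 → 𝒢` compatible with `autOfConj g` acts on `𝔾` by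
  `derivedActGraph g` (A2);
* `exists_conj_map_autOfConj_of_derivedActGraph_stable` — `hHstab` for every `ℍ₀ ⊆ 𝒢` stable under `derivedActGraph g`;
* at the origin record `P : SpecialFibreTower.PiData`: `derivedActGraph_vertexMap_eq_actGraph₀` (the derived action
  AGREES with the record's `actGraph₀` on vertices — both are the derived vertex action), `mem_H_verts_iff_derivedActGraph`
  (the record's `ℍ` is vertex-stable under the derived action), and ★★ `PiData.hHstab_of_derivedActGraph_stable` —
  abc-iut-L5's `hHstab` for EVERY decomposition group `TpH ∈ decompSubgroups S.chart P.H` and every `g`, from ONE law on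
  the record's `ℍ`: its NODES are stable under `derivedActGraph g` (the node-part law `actGraph₀` does not carry; for
  node-full `ℍ` nothing is needed, `hHstab_of_mem_decompSubgroups_of_full`).

HONEST RESIDUAL.  The record's `actGraph₀ g` and `derivedActGraph g` agree on VERTICES (proved); their agreement on
NODES is not derivable from `PiData`'s fields (abc-iut-L3-lead γ32 (2) witness) and is the natural law a successor of
the record would carry (L5-lead's call).  Nothing here is a claim about print beyond OUR finite carriers; no side is
taken on [IUTchIII] Cor. 3.12; nothing here asserts that abc is proved or refuted; typed ≠ proved.
-/

noncomputable section

namespace Literature.AnabelianGeometry.SemiGraphs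

open CategoryTheory ProfiniteSemiGraph
open scoped Pointwise

universe u

namespace SpecialFibreData

variable {K : Type u} [Field K] {D : TemperedArithmeticGroup K} (S : SpecialFibreData D)
  [Finite S.Gc.graph.Vertex] [Finite S.Gc.graph.Edge]
  (hK0 : (S.admissible.toMonoidHom.ker.map D.delta.subtype).Normal)

/-- **The vertex part of the derived action IS the derived vertex action `actVertex g`** (A3; Thm. 3.7 (iv) at the
finite `𝒢^c`). [cite: MochizukiSemiAnbd2006, Thm 3.7(iv) p.41] -/
theorem derivedActGraph_vertexMap (g : D.Pi) (v : S.graph.graph.Vertex) :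
    ((S.derivedActGraph hK0 g).hom.vertexMap v).1 = S.actVertex hK0 maximalCompactIffVerticialAt_of_finiteGraph g v.1 :=
  S.graphCompatible_autOfConj_vertexMap hK0 _ g (S.derivedHom_isIso hK0 g) (S.derivedHom_graphCompatible hK0 g) v

/-- **`Δ` acts trivially**: `derivedActGraph δ = 1` for `δ ∈ Δ` (`autOfConj δ` is inner, A5) — the derived action
factors through `Π/Δ = G_K`: print's "natural action of `G_K` on `𝔾`". [cite: Mochizuki2012, IUTchI Cor 2.3(i) p.47] -/
theorem derivedActGraph_coe_delta (δ : D.delta) : S.derivedActGraph hK0 (δ : D.Pi) = 1 := by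
  ext : 1
  exact S.graphCompatible_autOfConj_base_eq_id_of_mem_delta hK0 δ
    (S.derivedHom_isIso hK0 δ).isLocallyTrivial.isLocallyOpen (S.derivedHom_graphCompatible hK0 δ)

/-- `Δ` lies in the kernel of the derived action. [cite: Mochizuki2012, IUTchI Cor 2.3(i) p.47] -/
theorem delta_le_ker_derivedActGraph : D.delta ≤ (S.derivedActGraph hK0).ker := fun g hg => by
  rw [MonoidHom.mem_ker]
  exact S.derivedActGraph_coe_delta hK0 ⟨g, hg⟩

/-- **Every Cor-3.9-compatible locally open `F₀` for `autOfConj g` acts on `𝔾` by `derivedActGraph g`** (A2).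
[cite: MochizukiSemiAnbd2006, Cor 3.9 p.43] -/
theorem base_eq_derivedActGraph_hom (g : D.Pi) {F₀ : Hom S.graph S.graph} (hF₀ : F₀.IsLocallyOpen)
    (h : S.GraphCompatible S (S.autOfConj hK0 g) F₀) :
    (F₀.base : S.graph.graph ⟶ S.graph.graph) = (S.derivedActGraph hK0 g).hom :=
  S.base_eq_derivedHom_base hK0 g hF₀ h

/-- **`hHstab` for sub-semi-graphs stable under the derived action**: for `ℍ₀ ⊆ 𝒢` with
`(derivedActGraph g)⁻¹(ℍ₀) = ℍ₀` (vertices and edges) every decomposition subgroup `D` of `ℍ₀` (transported chart)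
satisfies `D.map (autOfConj g) = MulAut.conj t • D` for some `t`. [cite: Mochizuki2012, IUTchI Cor 2.3(i) p.47] -/
theorem exists_conj_map_autOfConj_of_derivedActGraph_stable (g : D.Pi) {H₀ : S.graph.graph.Subgraph}
    (hV : ∀ v, v ∈ H₀.verts ↔ (S.derivedActGraph hK0 g).hom.vertexMap v ∈ H₀.verts)
    (hE : ∀ e, e ∈ H₀.edges ↔ (S.derivedActGraph hK0 g).hom.edgeMap e ∈ H₀.edges) {Dg : Subgroup S.chart.G}
    (hD : Dg ∈ (S.chart.transport (haveI := S.isEquivalence_btempRestrict_graphOf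
        (S.Gc.btempRestrict S.Gc.graph.maximalSubgraph).asEquivalence.symm)).decompSubgroups H₀) :
    ∃ t : S.chart.G, Dg.map (S.autOfConj hK0 g).toMulEquiv.toMonoidHom = MulAut.conj t • Dg :=
  S.exists_conj_map_autOfConj_of_graphCompatible hK0 g (S.derivedHom_isIso hK0 g)
    (S.derivedHom_graphCompatible hK0 g) hV hE hD

end SpecialFibreData

/-! ### At the origin record `PiData` -/

namespace SpecialFibreTower

namespace PiData

open SpecialFibreData

variable {p : ℕ} [Fact p.Prime] {X : TemperedCurve p} {d : X.GroupLevelData}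
  {S : SpecialFibreData (X.toTemperedArithmeticGroup d)} {T : SpecialFibreTower X.DeltaTemp}

/-- **At the record, the derived action agrees with the record's `actGraph₀` on VERTICES** (gen 11's C2: both are
the derived vertex action). [cite: Mochizuki2012, IUTchI Cor 2.3(i) p.47] -/
theorem derivedActGraph_vertexMap_eq_actGraph₀ (P : PiData X d S T) (g : X.PiTemp) (v : S.graph.graph.Vertex) :
    haveI := P.finite_vertex; haveI := P.finite_edge
    ((S.derivedActGraph P.admissibleKer_normal_pi g).hom.vertexMap v).1 = (P.actGraph₀ g).hom.vertexMap v.1 := by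
  haveI := P.finite_vertex; haveI := P.finite_edge
  exact P.vertexMap_eq_actGraph₀_of_graphCompatible g
    (S.derivedHom_isIso P.admissibleKer_normal_pi g).isLocallyTrivial.isLocallyOpen
    (S.derivedHom_graphCompatible P.admissibleKer_normal_pi g) v

/-- The record's `ℍ ∩ 𝒢` is stable under the derived action on VERTICES (automatic: `H_stable` + agreement on
vertices). [cite: Mochizuki2012, IUTchI Cor 2.3 p.47] -/
theorem mem_H_verts_iff_derivedActGraph (P : PiData X d S T) (g : X.PiTemp) (v : S.graph.graph.Vertex) :
    haveI := P.finite_vertex; haveI := P.finite_edge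
    v ∈ (P.H.restrictTo S.Gc.graph.maximalSubgraph).verts ↔
      (S.derivedActGraph P.admissibleKer_normal_pi g).hom.vertexMap v ∈
        (P.H.restrictTo S.Gc.graph.maximalSubgraph).verts := by
  haveI := P.finite_vertex; haveI := P.finite_edge
  calc v ∈ (P.H.restrictTo S.Gc.graph.maximalSubgraph).verts ↔ v.1 ∈ P.H.verts := Iff.rfl
    _ ↔ (P.actGraph₀ g).hom.vertexMap v.1 ∈ P.H.verts := P.mem_H_verts_iff_actGraph₀ g v.1
    _ ↔ ((S.derivedActGraph P.admissibleKer_normal_pi g).hom.vertexMap v).1 ∈ P.H.verts := by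
        rw [P.derivedActGraph_vertexMap_eq_actGraph₀ g v]
    _ ↔ _ := Iff.rfl

/-- ★★ **`hHstab` at the record from node-stability of `ℍ` under the DERIVED action** — abc-iut-L5's
`hHstab_of_mem_decompSubgroups_of_graphic` with the origin datum `ActGraphInduces` replaced by ONE law on the
record's `ℍ`: its NODES are stable under `derivedActGraph g` (the edge law the record's own `actGraph₀` does not carry;
vertices are automatic).  For node-full `ℍ` even this is a theorem (`hHstab_of_mem_decompSubgroups_of_full`).
[cite: Mochizuki2012, IUTchI Cor 2.3(i) p.47] -/
theorem hHstab_of_derivedActGraph_stable (P : PiData X d S T) {TpH : Subgroup S.chart.G}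
    (hTpH : TpH ∈ S.chart.decompSubgroups P.H)
    (hHE : haveI := P.finite_vertex; haveI := P.finite_edge
      ∀ (g : X.PiTemp) (e : S.graph.graph.Edge), e.1 ∈ P.H.edges ↔
        ((S.derivedActGraph P.admissibleKer_normal_pi g).hom.edgeMap e).1 ∈ P.H.edges) :
    ∀ g : X.PiTemp, ∃ t : S.chart.G,
      TpH.map (S.autOfConj P.admissibleKer_normal_pi g).toMulEquiv.toMonoidHom = MulAut.conj t • TpH := by
  intro g
  haveI := P.finite_vertex; haveI := P.finite_edge
  exact P.hHstab_at_of_graphCompatible hTpH g (S.derivedHom_isIso P.admissibleKer_normal_pi g)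
    (S.derivedHom_graphCompatible P.admissibleKer_normal_pi g) (fun e => hHE g e)

end PiData

end SpecialFibreTower

end Literature.AnabelianGeometry.SemiGraphs

end
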